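import Literature.AnabelianGeometry.SemiGraphs.CoveringBranchFrames

/-!
# Branch frames, point form: `ι(Π_{b′}) = Π_b^{al} ∩ Stab(s₁)` ([SemiAnbd] Rem. 2.2.1 / 2.4.1)

Mochizuki, *Semi-graphs of anabelioids*, Publ. RIMS **42** (2006) 221–322, Rem. 2.2.1 p. 24
("`Π_{v'}` is the stabiliser … of a pro-vertex"), Rem. 2.4.1 p. 26 [cite: MochizukiSemiAnbd2006, Rem. 2.2.1 p.24].
abc-iut cell, layer L3, DISCHARGE-L3 §G (G30 toolkit, part 2; abc-iut-L4-t17, for the holders of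
G25-G9 `coveringHom_isBranchAligned` and of the double-coset fact): UNCONDITIONALLY (no alignment),
the image `ι(Π_{b′})` of the branch subgroup of a covering is the intersection of the ALIGNED branch
subgroup `Π_b^{al}` with the stabiliser of the POINT `s₁ = α(F_e(g)(t₀))` obtained from the edge
base point `t₀` (whose stabiliser in `Π_e` is `Im π₁(φ_{e′}^*)`, abc-iut-L6-t17
`range_pi1Map_eq_stabilizer`) by any morphism `g : C ⟶ b^* X` injective on fibres (e.g. the
branch-clause map `cE e′ ⟶ b^*(cV v′) ⟶ b^*(S_v)`) and the aligned frame `α`.  Consequently branch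
alignment (i), `ι⁻¹(Π_b^{al}) ≤ Π_{b′}`, is EQUIVALENT to the point statement
`Π_b^{al} ∩ ι(Π_{v′}) ≤ Stab(s₁)` — what a construction has to check.

* `Anabelioids.map_stabilizer_pi1Map_eq` — the generic identity
  `α(π₁(b^*)(Stab t₀)) = α(Im π₁(b^*)) ∩ Stab(α(F_e(g) t₀))` for `g` injective on fibres;
* `map_branchSubgroup_eq_aligned_inf_stabilizer` — the semi-graph form above.
Nothing here takes a side on [IUTchIII] Cor. 3.12; typed ≠ discharged.
-/

namespace Literature.AnabelianGeometry

open CategoryTheory CategoryTheory.Functor CategoryTheory.PreGaloisCategory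

namespace Anabelioids

universe w v u₁' u₃'

variable {V : Type u₁'} [Category.{v} V] {E : Type u₃'} [Category.{v} E]

/-- **Stabilisers through a branch frame.** For `P : V ⥤ E` (think `b^*`), basepoints `F_e` of `E`
and `F` of `V` with a frame `α : P ⋙ F_e ≅ F`, a point `t₀ ∈ F_e(C)` and a morphism `g : C ⟶ P X`
injective on `F_e`-fibres: the frame image of `π₁(P)(Stab t₀)` is the intersection of the frame image
of `Im π₁(P)` with the stabiliser of `α_X(F_e(g)(t₀)) ∈ F(X)` (naturality of automorphisms along `g`).
[cite: MochizukiSemiAnbd2006, Rem. 2.2.1 p.24] -/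
theorem map_stabilizer_pi1Map_eq (P : V ⥤ E) {Fe : E ⥤ FintypeCat.{w}} {F : V ⥤ FintypeCat.{w}}
    (α : P ⋙ Fe ≅ F) {C : E} (t₀ : Fe.obj C) {X : V} (g : C ⟶ P.obj X)
    (hg : Function.Injective (Fe.map g)) :
    ((MulAction.stabilizer (Aut Fe) t₀).map (pi1Map P Fe)).map
        (Aut.autMulEquivOfIso α).toMonoidHom =
      (pi1Map P Fe).range.map (Aut.autMulEquivOfIso α).toMonoidHom ⊓
        MulAction.stabilizer (Aut F) (α.hom.app X (Fe.map g t₀)) := by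
  -- the action of a frame image on the distinguished point
  have key : ∀ σ : Aut Fe,
      Aut.autMulEquivOfIso α (pi1Map P Fe σ) • α.hom.app X (Fe.map g t₀) =
        α.hom.app X (Fe.map g (σ • t₀)) := by
    intro σ
    rw [mulAction_def, mulAction_def]
    show (α.inv ≫ (pi1Map P Fe σ).hom ≫ α.hom).app X (α.hom.app X (Fe.map g t₀)) = _
    rw [NatTrans.comp_app, NatTrans.comp_app, FintypeCat.comp_apply, FintypeCat.comp_apply,
      ← FintypeCat.comp_apply (α.hom.app X) (α.inv.app X), Iso.hom_inv_id_app, FintypeCat.id_apply,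
      pi1Map_hom_app]
    exact congrArg (α.hom.app X) (NatTrans.naturality_apply σ.hom g t₀)
  have hαinj : Function.Injective (α.hom.app X) :=
    (FintypeCat.equivEquivIso.symm (α.app X)).injective
  ext x
  constructor
  · rintro ⟨_, ⟨σ, hσ, rfl⟩, rfl⟩
    exact ⟨⟨_, ⟨σ, rfl⟩, rfl⟩, (key σ).trans (congrArg (fun t => α.hom.app X (Fe.map g t)) hσ)⟩
  · rintro ⟨⟨_, ⟨σ, rfl⟩, rfl⟩, hx⟩
    exact ⟨_, ⟨σ, hg (hαinj ((key σ).symm.trans hx)), rfl⟩, rfl⟩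

end Anabelioids

namespace SemiGraphs

open Literature.AnabelianGeometry.Anabelioids

universe v₁ u₁ u

namespace SemiGraphOfAnabelioids

variable {𝒢 𝒢' : SemiGraphOfAnabelioids.{v₁, u₁, u}}

/-- **`ι(Π_{b′}) = Π_b^{al} ∩ Stab(s₁)`, unconditionally.** For a morphism `φ : 𝒢′ → 𝒢`, a branch
`b′` at `v′` over `b` (`p : φ(b′) = b`), basepoint data `(F′, F_e′, α′)`, a point `t₀` of the edge
basepoint `φ_{e′}^* ⋙ F_e′` whose stabiliser is `Im π₁(φ_{e′}^*)` ([SemiAnbd] Rem. 2.2.1 — for the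
covering attached to `A`, abc-iut-L6-t17's `range_pi1Map_eq_stabilizer`; `q` is any proof of
`φ(e′) = e(b)`, all choices being definitionally equal), and any `g : C ⟶ b^* X` injective on fibres: the image of `Π_{b′}` under `ι = π₁(φ_{v′}^*)` is the aligned branch subgroup cut
by the stabiliser of `s₁ := alignIso(F_e(g)(t₀)) ∈ (φ_{v′}^* ⋙ F′)(X)`.  Hence alignment (i) at `b′`
⟺ `Π_b^{al} ∩ ι(Π_{v′}) ≤ Stab(s₁)`. [cite: MochizukiSemiAnbd2006, Rem. 2.4.1 p.26] -/
theorem map_branchSubgroup_eq_aligned_inf_stabilizer (φ : Hom 𝒢' 𝒢) (b' : 𝒢'.graph.Branch)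
    (v' : 𝒢'.graph.Vertex) (h' : 𝒢'.graph.abuts b' = some v') (b : 𝒢.graph.Branch)
    (p : φ.base.branchMap b' = b) (F' : 𝒢'.V v' ⥤ FintypeCat.{v₁})
    (Fe' : 𝒢'.E (𝒢'.graph.edgeOf b') ⥤ FintypeCat.{v₁}) (α' : (𝒢'.pull b' v' h').pullback ⋙ Fe' ≅ F')
    (q : φ.base.edgeMap (𝒢'.graph.edgeOf b') = 𝒢.graph.edgeOf b) {C : 𝒢.E (𝒢.graph.edgeOf b)}
    (t₀ : ((φ.φE (𝒢'.graph.edgeOf b') (𝒢.graph.edgeOf b) q).pullback ⋙ Fe').obj C)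
    (ht₀ : (pi1Map (φ.φE (𝒢'.graph.edgeOf b') (𝒢.graph.edgeOf b) q).pullback Fe').range =
      MulAction.stabilizer _ t₀)
    {X : 𝒢.V (φ.base.vertexMap v')}
    (g : C ⟶ (𝒢.pull b (φ.base.vertexMap v') (p ▸ φ.base.abuts_branchMap b' v' h')).pullback.obj X)
    (hg : Function.Injective (((φ.φE (𝒢'.graph.edgeOf b') (𝒢.graph.edgeOf b) q).pullback ⋙ Fe').map g)) :
    (𝒢'.branchSubgroup F' b' h' Fe' α').map (pi1Map (φ.φV v').pullback F') =
      φ.alignedBranchSubgroup b' v' h' b p F' Fe' α' ⊓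
        MulAction.stabilizer _ ((φ.alignIso b' v' h' b p F' Fe' α').hom.app X
          (((φ.φE (𝒢'.graph.edgeOf b') (𝒢.graph.edgeOf b) q).pullback ⋙ Fe').map g t₀)) := by
  rw [map_branchSubgroup_eq_map_range_comp φ b' v' h' b p F' Fe' α', ht₀, Hom.alignedBranchSubgroup,
    branchSubgroup_eq_map_range, map_stabilizer_pi1Map_eq _ (φ.alignIso b' v' h' b p F' Fe' α') t₀ g hg]

end SemiGraphOfAnabelioids

end SemiGraphs

end Literature.AnabelianGeometry
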